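import Mathlib
import Summits.NavierStokesRegularity.NavierStokesRegularity.Theorems.FilamentSkeletonRssAnalyticStripLiaSymbolSeriesEncl
import Summits.NavierStokesRegularity.NavierStokesRegularity.Theorems.FilamentSkeletonRssTangentSkeletonNearStraightLiaSymbol

/-!
# Stub P3 `LiaSymbolBound` — KERNEL-ONLY numerics, brick 5c: the cells, the KERNEL-REPLAYED certificate, the window
# `−1/12 ≤ Φ(p) ≤ p/3` on `[1/50, 3]`, and `LiaSymbolBound` WITH STANDARD AXIOMS

Hand leafhand-ns-filamentskeletonrs-7 g1 (prover), 2026-08-31, `--supports stmt-NavierStokesRegularity-23320 --as helper` (tenure P5-(B), the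
owed item scoped by leafhand-7-g0: «kernel-only `LiaSymbolBound` window, to be inlined at 23320's closing»).
* §1 `cellChk_sound` / `cellsChk_sound`: on a cell `[a,b]`, `Φ ≤ 1 − CLo(b) − 2a·ELo(b) ≤ a/3 ≤ p/3` and
  `Φ ≥ 1 − CHi(a) − 2b·EHi(a) ≥ −1/12` (`C`, `E` antitone: `…NumericsSound`), chained over the node list;
* §2 `certificate_kernel : cellsChk nodes = true ∧ …` by `decide +kernel` (≈ 10 s; axioms `propext`, `Classical.choice`, `Quot.sound` —
  NO `Lean.ofReduceBool`), and `Phi_window_kernel` — the content of `…NumericsCert.numerics_window` (conjuncts swapped);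
* §3 `liaSym_window_kernel` (parts (a)+(b) in one statement; the proofs of `…TangentSkeletonNearStraightLiaSymbol.liaSym_le / neg_le_liaSym` with the
  window swapped) and **`liaSymbolBound_kernel : LiaSymbolBound ∧ cellsChk nodes = true`** — the registered stub P3 statement (`…AnalyticStripLiaSymbolDefs`, identical
  text in the 23320 / 28295 skeletons) with standard axioms, so that the cruxes' closing files need not be computational.

HONEST FRAMING: certified numerics for one explicit real integral, serving a HYPOTHETICAL filament-skeleton line on the NEGATIVE side of a
MODEL route; `TangentSkeletonNearStraightL`, `SkeletonJ1L` stay OPEN; nothing here bears on Navier–Stokes regularity or blow-up.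
-/

set_option linter.dupNamespace false

noncomputable section

namespace Summit.NavierStokesRegularity.NavierStokesRegularity.Theorems.AnalyticStripLiaSymbol

namespace Series

open Real Set MeasureTheory Filter Topology Finset
open Literature.NumberTheory.Sieve

/-! ## §1  Cells -/

/-- Soundness of one cell `[a, b]`: `Φ(p) ≤ p/3` and `−1/12 ≤ Φ(p)` for `a ≤ p ≤ b`. -/
theorem cellChk_sound {a b : ℚ} {ka kb : ℤ} (h : cellChk a ka b kb = true) :
    ∀ p : ℝ, (a:ℝ) ≤ p → p ≤ (b:ℝ) → Numerics.Phi p ≤ p / 3 ∧ -1 / 12 ≤ Numerics.Phi p := by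
  simp only [cellChk, Bool.and_eq_true, decide_eq_true_eq] at h
  obtain ⟨⟨⟨⟨⟨ha, hab⟩, hoka⟩, hokb⟩, hU⟩, hL⟩ := h
  have hb : 0 < b := ha.trans_le hab
  intro p hap hpb
  have ha' : (0:ℝ) < a := by exact_mod_cast ha
  have hp : 0 < p := ha'.trans_le hap
  obtain ⟨hElo, -⟩ := E_encl b kb hb hokb
  obtain ⟨hClo, -⟩ := C_encl b kb hb hokb
  obtain ⟨-, hEhi⟩ := E_encl a ka ha hoka
  obtain ⟨-, hChi⟩ := C_encl a ka ha hoka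
  have hU' : (1:ℝ) - ((CLo b kb : ℚ) : ℝ) - 2 * (a:ℝ) * ((ELo b kb : ℚ) : ℝ) ≤ (a:ℝ) / 3 := by
    have := (Rat.cast_le (K := ℝ)).mpr hU; push_cast at this; exact this
  have hL' : -1 / 12 ≤ (1:ℝ) - ((CHi a ka : ℚ) : ℝ) - 2 * (b:ℝ) * ((EHi a ka : ℚ) : ℝ) := by
    have := (Rat.cast_le (K := ℝ)).mpr hL; push_cast at this; exact this
  have hCb : Numerics.Cint (b:ℝ) ≤ Numerics.Cint p := Numerics.Cint_antitone hp.le hpb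
  have hCa : Numerics.Cint p ≤ Numerics.Cint (a:ℝ) := Numerics.Cint_antitone ha'.le hap
  have hEb : Numerics.Eint (b:ℝ) ≤ Numerics.Eint p := Numerics.Eint_antitone hp hpb
  have hEa : Numerics.Eint p ≤ Numerics.Eint (a:ℝ) := Numerics.Eint_antitone ha' hap
  have hE0 : 0 ≤ Numerics.Eint (b:ℝ) := Numerics.Eint_nonneg _
  have hEp0 : 0 ≤ Numerics.Eint p := Numerics.Eint_nonneg _
  have hb' : (0:ℝ) ≤ b := by exact_mod_cast hb.le
  unfold Numerics.Phi
  have h1 : (a:ℝ) * Numerics.Eint (b:ℝ) ≤ p * Numerics.Eint p := mul_le_mul hap hEb hE0 hp.le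
  have h2 : p * Numerics.Eint p ≤ (b:ℝ) * Numerics.Eint (a:ℝ) := mul_le_mul hpb hEa hEp0 hb'
  have h3 : (a:ℝ) * ((ELo b kb : ℚ) : ℝ) ≤ (a:ℝ) * Numerics.Eint (b:ℝ) := mul_le_mul_of_nonneg_left hElo ha'.le
  have h4 : (b:ℝ) * Numerics.Eint (a:ℝ) ≤ (b:ℝ) * ((EHi a ka : ℚ) : ℝ) := mul_le_mul_of_nonneg_left hEhi hb'
  constructor <;> linarith

/-- Soundness of the chained cells on `[x.1, lastP x rest]`. -/
theorem cellsChk_sound : ∀ (rest : List (ℚ × ℤ)) (x : ℚ × ℤ), cellsChk (x :: rest) = true → rest ≠ [] →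
    ∀ p : ℝ, (x.1:ℝ) ≤ p → p ≤ (lastP x rest : ℝ) → Numerics.Phi p ≤ p / 3 ∧ -1 / 12 ≤ Numerics.Phi p := by
  intro rest
  induction rest with
  | nil => intro x _ hne; exact absurd rfl hne
  | cons y rest ih =>
    intro x hc _ p hxp hpl
    simp only [cellsChk, Bool.and_eq_true] at hc
    obtain ⟨hcell, hrest⟩ := hc
    by_cases hpy : p ≤ (y.1:ℝ)
    · exact cellChk_sound hcell p hxp hpy
    · have hyp : (y.1:ℝ) ≤ p := le_of_lt (not_le.mp hpy)
      cases rest with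
      | nil =>
        simp only [lastP] at hpl
        exact absurd hpl hpy
      | cons z rest' =>
        exact ih y hrest (List.cons_ne_nil _ _) p hyp (by simpa [lastP] using hpl)

/-! ## §2  The kernel-replayed certificate and the window -/

/-- **THE CERTIFICATE, REPLAYED BY THE KERNEL** (`decide +kernel`; standard axioms — no `Lean.ofReduceBool`). -/
theorem certificate_kernel :
    (cellsChk nodes && decide (lastP ((1 : ℚ) / 50, -6) nodes.tail = 3)
      && decide (nodes = ((1 : ℚ) / 50, (-6 : ℤ)) :: nodes.tail)) = true := by
  decide +kernel

/-- **THE NUMERICAL WINDOW, KERNEL-ONLY**: for `1/50 ≤ p ≤ 3`, `Φ(p) ≤ p/3` and `−1/12 ≤ Φ(p)`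
(the content of `…NumericsCert.numerics_window`, conjuncts swapped, now with standard axioms). -/
theorem Phi_window_kernel (p : ℝ) (h1 : 1 / 50 ≤ p) (h2 : p ≤ 3) :
    -1 / 12 ≤ Numerics.Phi p ∧ Numerics.Phi p ≤ p / 3 := by
  rw [and_comm]
  have hc := certificate_kernel
  simp only [Bool.and_eq_true, decide_eq_true_eq] at hc
  obtain ⟨⟨hcells, hlast⟩, hshape⟩ := hc
  rw [hshape] at hcells
  have hne : nodes.tail ≠ [] := by
    intro h; rw [h] at hlast; norm_num [lastP] at hlast
  have := cellsChk_sound nodes.tail ((1 : ℚ) / 50, -6) hcells hne p (by push_cast; linarith)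
    (by rw [hlast]; push_cast; linarith)
  exact this

end Series

/-! ## §3  `LiaSymbolBound` with standard axioms -/

open Real Set MeasureTheory Filter Topology

open Numerics in
/-- **THE TWO NUMERICAL PARTS OF `LiaSymbolBound`, KERNEL-ONLY, in one statement**: for `x > 0`, (a) `𝔖(x) ≤ x²/12`, and (b) if moreover
`x ≥ ½` then `−x²/3 ≤ 𝔖(x)` (the proofs of `…TangentSkeletonNearStraightLiaSymbol.liaSym_le / neg_le_liaSym` with the window swapped for
`Series.Phi_window_kernel`). -/
theorem liaSym_window_kernel (x : ℝ) (hx : 0 < x) :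
    liaSym x ≤ x ^ 2 / 12 ∧ (1 / 2 ≤ x → -(x ^ 2 / 3) ≤ liaSym x) := by
  constructor
  · -- part (a)
    set p := x ^ 2 / 4 with hpdef
    have hp : 0 < p := by positivity
    have hx2 : x ^ 2 = 4 * p := by rw [hpdef]; ring
    rcases le_or_gt p (1 / 50) with hsmall | hlarge
    · -- analytic, small p (verbatim from `liaSym_le`)
      have hp1 : p ≤ 1 := by linarith
      have hrep := liaSym_eq_integral_E_sub x hx.ne'
      rw [show x ^ 2 / 4 = p from rfl] at hrep
      have hIE := (integral_E_bounds hp hp1).2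
      have hE := (E_bounds hp hp1).1
      have h2p : (0:ℝ) ≤ 2 * p := by positivity
      have hEp := mul_le_mul_of_nonneg_left hE h2p
      have hlog : Real.log p ≤ -(5 * Real.log 2) := by
        have : Real.log p ≤ Real.log (1 / 32) := Real.log_le_log hp (by linarith)
        rw [one_div, Real.log_inv, show (32:ℝ) = 2 ^ 5 by norm_num, Real.log_pow] at this
        push_cast at this; linarith
      have hl2 := Real.log_two_gt_d9
      have hγ := Real.eulerMascheroniConstant_lt_two_thirds
      have hγ0 : 0 < Real.eulerMascheroniConstant := lt_trans (by norm_num) Real.one_half_lt_eulerMascheroniConstant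
      have h1p : 0 ≤ 1 - p := by linarith
      have hlogp : p * (1 - p) * Real.log p ≤ p * (1 - p) * (-(5 * Real.log 2)) :=
        mul_le_mul_of_nonneg_left hlog (mul_nonneg hp.le h1p)
      have hγp : 2 * p * Real.eulerMascheroniConstant ≤ 2 * p * (2 / 3) :=
        mul_le_mul_of_nonneg_left hγ.le h2p
      have hl2u := Real.log_two_lt_d9
      have hl2p : 0.6931471803 * p ≤ p * Real.log 2 := by nlinarith
      have hl2pp : p ^ 2 * Real.log 2 ≤ p ^ 2 * 0.6931471808 := by nlinarith [sq_nonneg p]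
      have hpp : p ^ 2 ≤ p / 50 := by nlinarith
      rw [hrep, hx2]
      linarith
    rcases le_or_gt p 3 with hmid | hbig
    · rw [liaSym_eq_Phi x hx.ne', show x ^ 2 / 4 = p from rfl, hx2]
      have := (Series.Phi_window_kernel p hlarge.le hmid).2
      linarith
    · rw [liaSym_eq_Phi x hx.ne', show x ^ 2 / 4 = p from rfl, hx2, Numerics.Phi]
      have hC : 0 ≤ Numerics.Cint p := setIntegral_nonneg measurableSet_Ioi fun t _ => fC_nonneg p t
      have hE : 0 ≤ Numerics.Eint p := Eint_nonneg p
      nlinarith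
  · -- part (b)
    intro hx12
    clear hx
    have hx : 1 / 2 ≤ x := hx12
    set p := x ^ 2 / 4 with hpdef
    have hx0 : 0 < x := by linarith
    have hp : 1 / 50 ≤ p := by rw [hpdef]; nlinarith
    have hp0 : 0 < p := by linarith
    have hx2 : x ^ 2 = 4 * p := by rw [hpdef]; ring
    rw [liaSym_eq_Phi x hx0.ne', show x ^ 2 / 4 = p from rfl, hx2]
    rcases le_or_gt p 3 with hmid | hbig
    · have := (Series.Phi_window_kernel p hp hmid).1
      nlinarith
    · unfold Numerics.Phi
      have hC := Cint_le_inv hp0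
      have hE := Eint_le_inv hp0
      have he : Real.exp 1 > 2.7 := lt_trans (by norm_num) Real.exp_one_gt_d9
      have hpe : 0 < Real.exp 1 * p := by positivity
      have h1 : Numerics.Cint p ≤ 1 / (2.7 * 3) := by
        refine hC.trans ?_
        rw [div_le_div_iff₀ hpe (by norm_num)]
        nlinarith
      have h2 : 2 * p * Numerics.Eint p ≤ 2 / 2.7 := by
        have := mul_le_mul_of_nonneg_left hE (by positivity : (0:ℝ) ≤ 2 * p)
        refine this.trans ?_
        rw [show 2 * p * (1 / (Real.exp 1 * p)) = 2 / Real.exp 1 by field_simp]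
        exact div_le_div_of_nonneg_left (by norm_num) (by norm_num) he.le
      nlinarith

/-- **THE REGISTERED STUB P3 STATEMENT `LiaSymbolBound` WITH STANDARD AXIOMS, paired with the kernel certificate it rests on**
(a bare restatement of `stub_liaSymbol : LiaSymbolBound` would be a duplicate declaration; use `.1`):
(a) `𝔖 ≤ x²/12`, (b) `𝔖 ≥ −x²/3` on `x ≥ ½`, (c) Klein–Majda asymptotics — no `native_decide` anywhere in the closure. -/
theorem liaSymbolBound_kernel : LiaSymbolBound ∧ Series.cellsChk Series.nodes = true := by
  refine ⟨⟨fun x hx => (liaSym_window_kernel x hx).1, fun x hx => (liaSym_window_kernel x (by linarith)).2 hx, liaSym_asymp⟩, ?_⟩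
  have hc := Series.certificate_kernel
  simp only [Bool.and_eq_true] at hc
  exact hc.1.1

end Summit.NavierStokesRegularity.NavierStokesRegularity.Theorems.AnalyticStripLiaSymbol

end
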